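import Summits.Ventures.Crystal3D.Theorems.StickyWulffConstantNoReconstructionGainTwoLevel
import Summits.Ventures.Crystal3D.Theorems.StickyWulffConstantNoReconstructionGainWindowRows
import HarnessLib

/-!
# Bilayer-confined `(111)` criminals live in the upper middle band (anatomy from the `W = √(2/3)` rows)
# (crux `NoReconstructionGain`, stmt-Ventures-19144, line `replication-exactness`, inside `stub_noCriminal`)

HONEST FRAMING. Part of the venture `Summits/Ventures/Crystal3D` (cell `crystal3d-full`), helper `--supports` the
crux `NoReconstructionGain` (stmt-Ventures-19144, route `route-Ventures-StickyWulffConstant`), lead wulff-p1 g24.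
The FILM-LEVEL reading of this lead's rows of the `W = c := √(2/3)` windowed weighted-kissing certificate
(`hollowRow_ramp`, `confinedRow_ramp_of_neg_half_le`, `topRow_ramp_of_card_ne`) through the ball-by-ball reduction
(`not_isCriminal_basal_of_rows_card`: the variant of `not_isCriminal_basal_of_rows` that also hands the row the
partner COUNT of the ball, needed by the top row); an ANATOMY statement, not the bilayer-hollow class itself.

* **`not_isCriminal_basal_bilayer_of_noMiddle`** — a `(111)` film over layer `k` (`kc ≤ s < (k+1)c`) confined
  below `(k+2)c` in which NO ball has height in the open band `((k+1)c + c/2, (k+2)c)` and every ball AT height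
  `(k+2)c` has a number of partners (plugs + film balls at distance `1`) different from `7` and `8` is not a
  criminal.  Contrapositive (the anatomy): **every `(111)` criminal confined below `(k+2)√(2/3)` has a ball strictly
  inside the upper middle band `((k+1)c + c/2, (k+2)c)`, or a ball at exactly `(k+2)c` with exactly `7` or `8`
  partners** — the two SLACK, certificate-shaped rows of the window (cell memo HOLLOW-g24 §2b) are exactly where a
  bilayer criminal must sit.

WHAT THIS IS NOT: not «no criminal below `(k+2)c`» (the bilayer-hollow class: its plug-free rows `a ∈ [−c, −c/2)`
are open); rung F-C1 not moved.
-/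

noncomputable section

namespace Summit.Ventures.Crystal3D.Theorems

open Summit.Ventures.Crystal3D Finset
open scoped InnerProductSpace

open Literature.MathematicalPhysics.StatisticalMechanics (isHaggSeq_const le_dist_of_mem_barlowStacking_ideal) in
/-- **Reduction with ball-indexed rows and the partner count** (variant of `not_isCriminal_basal_of_rows`
recording that the code handed to the row has exactly as many members as the ball has partners).  Over the close-packed layer `k` (`kc ≤ s < (k+1)c`, `c = √(2/3)`), let
`g` satisfy `g z + g (−z) = 2` and `g = 2` on `z ≤ −c`.  If for every ball `q ∈ Q` and every finite `60°`-code `N`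
whose members have third coordinate `kc − q₂` (the plug directions of `q`) or `x₂ − q₂` for some `x ∈ Q` (the
directions to film partners), `Σ_{u∈N} g(u₂) ≤ 12`, then `Q` is not a criminal on `H(e₃, s)`. -/
theorem not_isCriminal_basal_of_rows_card (k : ℤ) {s : ℝ} (hs : (k : ℝ) * Real.sqrt (2 / 3) ≤ s)
    (hs' : s < ((k : ℝ) + 1) * Real.sqrt (2 / 3)) {g : ℝ → ℝ} (hsym : ∀ z, g z + g (-z) = 2)
    (hplug : ∀ z, z ≤ -Real.sqrt (2 / 3) → g z = 2) {Q : Finset (EuclideanSpace ℝ (Fin 3))}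
    (hrow : ∀ q ∈ Q, ∀ N : Finset (EuclideanSpace ℝ (Fin 3)), (∀ u ∈ N, ‖u‖ = 1) →
      (∀ u ∈ N, ∀ v ∈ N, u ≠ v → ⟪u, v⟫_ℝ ≤ 1 / 2) →
      (∀ u ∈ N, u 2 = (k : ℝ) * Real.sqrt (2 / 3) - q 2 ∨ ∃ x ∈ Q, u 2 = x 2 - q 2) →
      N.card = (plugSet (EuclideanSpace.single 2 (1 : ℝ)) s q).ncard + (Q.filter fun y => dist q y = 1).card →
      ∑ u ∈ N, g (u 2) ≤ 12) :
    ¬ IsCriminal (EuclideanSpace.single 2 (1 : ℝ)) s Q := by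
  classical
  intro hcrim
  have hQ : IsFilmOn (EuclideanSpace.single 2 (1 : ℝ)) s Q := hcrim.1
  set ν : EuclideanSpace ℝ (Fin 3) := EuclideanSpace.single 2 (1 : ℝ) with hν
  set c : ℝ := Real.sqrt (2 / 3) with hc
  have h23 : Real.sqrt (2 / 3) ^ 2 = 2 / 3 * (1 : ℝ) ^ 2 := by rw [Real.sq_sqrt (by norm_num)]; norm_num
  refine not_isCriminal_of_fracOrientation (ν := ν) (s := s) (fun x q => g ((x - q) 2) / 2)
    (fun q _ q' _ _ => ?_) (fun q hq => ?_) hcrim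
  · have : (q - q') 2 = -((q' - q) 2) := by simp [PiLp.sub_apply]
    rw [this]; linarith [hsym ((q' - q) 2)]
  · set P : Finset (EuclideanSpace ℝ (Fin 3)) := (plugSet_finite ν s q).toFinset with hP
    set F : Finset (EuclideanSpace ℝ (Fin 3)) := Q.filter (fun q' => dist q q' = 1) with hF
    have hPmem : ∀ p, p ∈ P ↔ p ∈ plugSet ν s q := fun p => by rw [hP, Set.Finite.mem_toFinset]
    have hFmem : ∀ x, x ∈ F ↔ x ∈ Q ∧ dist q x = 1 := fun x => by rw [hF, Finset.mem_filter]
    have hdist1 : ∀ x ∈ F ∪ P, dist q x = 1 := by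
      intro x hx
      rcases Finset.mem_union.1 hx with hx | hx
      · exact ((hFmem x).1 hx).2
      · exact ((hPmem x).1 hx).2
    have hsep : ∀ x ∈ F ∪ P, ∀ x' ∈ F ∪ P, x ≠ x' → 1 ≤ dist x x' := by
      intro x hx x' hx' hne
      rcases Finset.mem_union.1 hx with hx | hx <;> rcases Finset.mem_union.1 hx' with hx' | hx'
      · exact hQ.1 x ((hFmem x).1 hx).1 x' ((hFmem x').1 hx').1 hne
      · exact hQ.2 x ((hFmem x).1 hx).1 x' ((hPmem x').1 hx').1
      · rw [dist_comm]; exact hQ.2 x' ((hFmem x').1 hx').1 x ((hPmem x).1 hx).1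
      · exact le_dist_of_mem_barlowStacking_ideal isHaggSeq_const one_pos h23 ((hPmem x).1 hx).1.1
          ((hPmem x').1 hx').1.1 hne
    have hdisj : Disjoint F P := by
      rw [Finset.disjoint_left]
      intro x hxF hxP
      have h := hQ.2 x ((hFmem x).1 hxF).1 x ((hPmem x).1 hxP).1
      rw [dist_self] at h
      exact absurd h (by norm_num)
    set N : Finset (EuclideanSpace ℝ (Fin 3)) := (F ∪ P).image (fun x => x - q) with hN
    have hinj : Set.InjOn (fun x => x - q) ↑(F ∪ P) := fun x _ x' _ h => sub_left_injective h
    have hN1 : ∀ u ∈ N, ‖u‖ = 1 := by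
      intro u hu
      obtain ⟨x, hx, rfl⟩ := Finset.mem_image.1 hu
      rw [← dist_eq_norm, dist_comm]; exact hdist1 x hx
    have hN2 : ∀ u ∈ N, ∀ v ∈ N, u ≠ v → ⟪u, v⟫_ℝ ≤ 1 / 2 := by
      intro u hu v hv huv
      obtain ⟨x, hx, rfl⟩ := Finset.mem_image.1 hu
      obtain ⟨x', hx', rfl⟩ := Finset.mem_image.1 hv
      have hne : x ≠ x' := fun h => huv (by rw [h])
      exact real_inner_sub_le_half_of_dist (hdist1 x hx) (hdist1 x' hx') (hsep x hx x' hx' hne)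
    have hN3 : ∀ u ∈ N, u 2 = (k : ℝ) * Real.sqrt (2 / 3) - q 2 ∨ ∃ x ∈ Q, u 2 = x 2 - q 2 := by
      intro u hu
      obtain ⟨x, hx, rfl⟩ := Finset.mem_image.1 hu
      rw [PiLp.sub_apply]
      rcases Finset.mem_union.1 hx with hx | hx
      · exact Or.inr ⟨x, ((hFmem x).1 hx).1, rfl⟩
      · left
        rw [plug_apply_two_eq_basal k hs hs' hQ hq ((hPmem x).1 hx)]
    have hNcard : N.card = (plugSet ν s q).ncard + (Q.filter fun y => dist q y = 1).card := by
      rw [hN, Finset.card_image_of_injOn hinj, Finset.card_union_of_disjoint hdisj, hP,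
        Set.ncard_eq_toFinset_card _ (plugSet_finite ν s q), hF, add_comm]
    have hbound := hrow q hq N hN1 hN2 hN3 hNcard
    rw [hN, Finset.sum_image hinj, Finset.sum_union hdisj] at hbound
    have hPsum : ∑ x ∈ P, g ((x - q) 2) = 2 * (P.card : ℝ) := by
      rw [Finset.sum_congr rfl fun x hx => ?_, Finset.sum_const, nsmul_eq_mul, mul_comm]
      rw [PiLp.sub_apply, plug_apply_two_eq_basal k hs hs' hQ hq ((hPmem x).1 hx)]
      apply hplug
      have := le_height_of_isFilmOn_basal k hs hQ hq
      linarith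
    have hcard : ((plugSet ν s q).ncard : ℝ) = P.card := by
      rw [hP, Set.ncard_eq_toFinset_card _ (plugSet_finite ν s q)]
    rw [hPsum] at hbound
    rw [hcard, ← Finset.sum_div]
    have : ∑ x ∈ F, g ((x - q) 2) = ∑ i ∈ F, g ((i - q) 2) := rfl
    linarith


open scoped Classical in
/-- **Bilayer-confined criminals live in the upper middle band.**  Over the close-packed layer `k` of `Λ₀`
(`k√(2/3) ≤ s < (k+1)√(2/3)`), let `Q` be a film confined below `(k+2)√(2/3)` such that (i) no ball has height
strictly between `(k+1)√(2/3) + √(2/3)/2` and `(k+2)√(2/3)`, and (ii) every ball at height `(k+2)√(2/3)` has a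
partner count (plugs plus film balls at distance `1`) different from `7` and from `8`.  Then `Q` is not a criminal
on `H(e₃, s)`. -/
theorem not_isCriminal_basal_bilayer_of_noMiddle (k : ℤ) {s : ℝ} (hs : (k : ℝ) * Real.sqrt (2 / 3) ≤ s)
    (hs' : s < ((k : ℝ) + 1) * Real.sqrt (2 / 3)) {Q : Finset (EuclideanSpace ℝ (Fin 3))}
    (hconf : ∀ q ∈ Q, q 2 ≤ ((k : ℝ) + 2) * Real.sqrt (2 / 3))
    (hnomid : ∀ q ∈ Q, q 2 ≤ ((k : ℝ) + 1) * Real.sqrt (2 / 3) + Real.sqrt (2 / 3) / 2 ∨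
      q 2 = ((k : ℝ) + 2) * Real.sqrt (2 / 3))
    (htop : ∀ q ∈ Q, q 2 = ((k : ℝ) + 2) * Real.sqrt (2 / 3) →
      (plugSet (EuclideanSpace.single 2 (1 : ℝ)) s q).ncard + (Q.filter fun y => dist q y = 1).card ≠ 7 ∧
      (plugSet (EuclideanSpace.single 2 (1 : ℝ)) s q).ncard + (Q.filter fun y => dist q y = 1).card ≠ 8) :
    ¬ IsCriminal (EuclideanSpace.single 2 (1 : ℝ)) s Q := by
  intro hcrim
  have hQ : IsFilmOn (EuclideanSpace.single 2 (1 : ℝ)) s Q := hcrim.1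
  set ν : EuclideanSpace ℝ (Fin 3) := EuclideanSpace.single 2 (1 : ℝ) with hν
  set c : ℝ := Real.sqrt (2 / 3) with hc
  have hc2 : c ^ 2 = 2 / 3 := Real.sq_sqrt (by norm_num)
  have hcpos : 0 < c := Real.sqrt_pos.2 (by norm_num)
  set g : ℝ → ℝ := fun z => min 2 (max 0 (1 - z / c)) with hg
  have hclip : ∀ t : ℝ, min 2 (max 0 (1 - t)) + min 2 (max 0 (1 + t)) = 2 := by
    intro t
    simp only [min_def, max_def]
    split_ifs <;> linarith
  have hsym : ∀ z, g z + g (-z) = 2 := by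
    intro z
    have h := hclip (z / c)
    simp only [hg, neg_div]
    rwa [sub_neg_eq_add]
  have hplug : ∀ z, z ≤ -c → g z = 2 := by
    intro z hz
    have : 2 ≤ 1 - z / c := by
      have : z / c ≤ -1 := by rw [div_le_iff₀ hcpos]; linarith
      linarith
    simp only [hg]
    rw [max_eq_right (by linarith), min_eq_left this]
  refine not_isCriminal_basal_of_rows_card k hs hs' hsym hplug (fun q hq N hN1 hN2 hN3 hNc => ?_) hcrim
  have hqlo := le_height_of_isFilmOn_basal k hs hQ hq
  -- the offset of `q`
  set a : ℝ := ((k : ℝ) + 1) * c - q 2 with ha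
  have ha0 : a ≤ 0 := by rw [ha]; linarith
  -- every member of `N` is a plug direction (`a − c`) or a partner direction (in `[a, a + c]`)
  have hwin : ∀ u ∈ N, u 2 = a - c ∨ (a ≤ u 2 ∧ u 2 ≤ a + c) := by
    intro u hu
    rcases hN3 u hu with h | ⟨x, hx, h⟩
    · left; rw [h, ha]; ring
    · right
      have hxlo := le_height_of_isFilmOn_basal k hs hQ hx
      have hxhi := hconf x hx
      rw [h, ha]; constructor <;> linarith
  rcases hnomid q hq with hlow | htopq
  · -- lower half: `a ∈ [−c/2, 0]`
    have haW : -(c / 2) ≤ a := by rw [ha]; linarith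
    exact confinedRow_ramp_of_neg_half_le haW ha0 N hN1 hN2 hwin
  · -- top level: `a = −c`, no plugs, partner count `≠ 7, 8`
    have hac : a = -c := by rw [ha, htopq]; ring
    have hwin' : ∀ u ∈ N, u 2 = -c - c ∨ (-c ≤ u 2 ∧ u 2 ≤ -c + c) := by
      intro u hu; have := hwin u hu; rwa [hac] at this
    have h7 : N.card ≠ 7 := by rw [hNc]; exact (htop q hq htopq).1
    have h8 : N.card ≠ 8 := by rw [hNc]; exact (htop q hq htopq).2
    exact topRow_ramp_of_card_ne N hN1 hN2 hwin' h7 h8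

end Summit.Ventures.Crystal3D.Theorems

end
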